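import Literature.NumberTheory.Transcendental.DolbeaultAcyclicHolomorphicRepresentatives
import Literature.Analysis.Complex.PQDimension
import Literature.Analysis.Complex.DolbeaultVanishingRunge
import HarnessLib

/-!
# `Hʳ_dR(M; ℂ) = 0` for `r > dim M` on a `∂̄`-acyclic complex manifold (Hörmander, Thm. 5.2.7 / 2.7.11)

[topic Geometry/Kaehler]

Hörmander, *An Introduction to Complex Analysis in Several Variables* (1973):

* **Theorem 2.7.10 / Lemma 2.7.9** (p. 59–60): on an open set where `∂̄u = f` is solvable in
  `C^∞_{(p,q)}` for all `∂̄`-closed `f ∈ C^∞_{(p,q+1)}`, every `d`-closed form of degree `r` is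
  `d`-cohomologous to a `d`-closed form of type `(r,0)` (with holomorphic coefficients);
* **Theorem 2.7.11.** "If `Ω` is a Runge domain in `ℂⁿ`, then `Hʳ(Ω, ℂ) = 0` when `r ≥ n`";
* **Theorem 5.2.7.** "If `Ω` is a Stein manifold of dimension `n`, then `Hʳ(Ω, ℂ) = 0` when `r > n`."

The mechanism of 2.7.10 is in the tree as
`Literature.NumberTheory.Transcendental.exists_isHolomorphicForm_mk_eq_of_forall_subsingleton`
(El Zein–Tu Cor. 2.5.3: on a manifold with `H^{p,q+1}_{∂̄} = 0` for all `p, q` every class of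
`Hᵏ_dR(M; ℂ)` has a closed holomorphic representative of type `(k,0)`). Since a form of type `(p,q)`
with `p > dim_ℂ E` vanishes (`dim Λ^{p,q} = C(n,p)·C(n,q)`,
`Literature.Analysis.Complex.finrank_typeSubmodule`), this file concludes:

* `MForm.eq_zero_of_isOfType_of_finrank_lt` — a form of type `(p,q)` with `p > n` (or `q > n`) on a
  manifold charted on `E`, `dim_ℂ E = n`, is zero;
* **`subsingleton_complexDeRhamCohomology_of_forall_subsingleton_dolbeaultCohomology`** — Theorem
  5.2.7 in `∂̄`-form: if `H^{p,q+1}_{∂̄}(M) = 0` for all `p, q` (the conclusion of Cartan's Theorem B /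
  Hörmander's Cor. 5.2.6 on a Stein manifold), then `Hʳ_dR(M; ℂ) = 0` for every `r > dim_ℂ E`, in the
  tree's smooth-forms de Rham cohomology `complexDeRhamCohomology`;
* instances on open submanifolds of `ℂ^ι`: **`subsingleton_complexDeRhamCohomology_of_holomorphicHull_subset`**
  (Theorem 2.7.11 for `r > n`: Runge open sets, `K̃ ⊆ Ω` for all compact `K ⊆ Ω`),
  `subsingleton_complexDeRhamCohomology_of_forall_norm_lt_of_forall_ne_zero` (open analytic polyhedra
  minus entire hypersurfaces, e.g. `(ℂ^*)^S × ℂ^{ι∖S}`, basic opens `D(Q)`), from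
  `Literature/Analysis/Complex/DolbeaultVanishingRunge.lean` / `DolbeaultVanishingPolyhedra.lean`.

Everything is proved; theorems only; no named facts. NOT here: the case `r = n` of Theorem 2.7.11
(which needs the duality argument of p. 60–61), and the identification of `complexDeRhamCohomology`
with singular cohomology (the tree's de Rham theorem, `exists_complexDeRhamIsoFamily_holds`).

## References

* L. Hörmander, *An Introduction to Complex Analysis in Several Variables*, 2nd ed. (1973), Lemma 2.7.9,
  Thm. 2.7.10, Thm. 2.7.11, Cor. 5.2.6, Thm. 5.2.7. [HormanderSCV1973]
* E. Cattani, F. El Zein, P. Griffiths, Lê D. T. (eds.), *Hodge Theory* (2014), Ch. 2 Cor. 2.5.3.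
  [CattaniElZeinGriffithsLe2014]
* C. Voisin, *Hodge Theory and Complex Algebraic Geometry I* (2002), §2.3.1 eq. (2.4). [Voisin2002]
-/

noncomputable section

open scoped Manifold ContDiff Topology
open Set Function
open Literature.Geometry.Kaehler Literature.NumberTheory.Transcendental Literature.Analysis.Complex

namespace Literature.Geometry.Kaehler

universe u

variable {E : Type*} [NormedAddCommGroup E] [NormedSpace ℂ E] [FiniteDimensional ℂ E]
  {M : Type*} [TopologicalSpace M] [ChartedSpace E M]

/-! ### Forms of type `(p,q)` with `p > n` or `q > n` vanish -/

omit [FiniteDimensional ℂ E] in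
/-- The space `Λ^k(E; ℂ)` of complex-valued real-alternating forms on a finite-dimensional complex
normed space is finite-dimensional over `ℂ` (cf. `finiteDimensional_complex_forms` for `ℂ^ι`).
[folklore] -/
private theorem finiteDimensional_forms [FiniteDimensional ℂ E] (k : ℕ) :
    FiniteDimensional ℂ (E [⋀^Fin k]→L[ℝ] ℂ) := by
  haveI : Module.Finite ℝ (E [⋀^Fin k]→L[ℝ] ℂ) := moduleFinite_continuousAlternatingMap k
  exact Module.Finite.of_restrictScalars_finite ℝ ℂ _

/-- On a complex vector space `E` of dimension `n`, `Λ^{p,q}(E) = 0` when `p > n`: its dimension is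
`C(n,p)·C(n,q) = 0` (`finrank_typeSubmodule`). [cite: Voisin2002, §2.3.1 eq. (2.4)] -/
theorem typeSubmodule_eq_bot_of_finrank_lt_left {k p q : ℕ} (hpq : p + q = k)
    (hp : Module.finrank ℂ E < p) : typeSubmodule E k p q = ⊥ := by
  haveI := finiteDimensional_forms (E := E) k
  rw [← Submodule.finrank_eq_zero, finrank_typeSubmodule hpq, Nat.choose_eq_zero_of_lt hp, zero_mul]

/-- On a complex vector space `E` of dimension `n`, `Λ^{p,q}(E) = 0` when `q > n`.
[cite: Voisin2002, §2.3.1 eq. (2.4)] -/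
theorem typeSubmodule_eq_bot_of_finrank_lt_right {k p q : ℕ} (hpq : p + q = k)
    (hq : Module.finrank ℂ E < q) : typeSubmodule E k p q = ⊥ := by
  haveI := finiteDimensional_forms (E := E) k
  rw [← Submodule.finrank_eq_zero, finrank_typeSubmodule hpq, Nat.choose_eq_zero_of_lt hq, mul_zero]

/-- **A form of type `(p,q)` with `p > dim_ℂ E` is zero** (pointwise it lies in `Λ^{p,q} = 0`).
[cite: Voisin2002, §2.3.1 eq. (2.4)] -/
theorem MForm.eq_zero_of_isOfType_of_finrank_lt_left {k p q : ℕ} {α : MForm 𝓘(ℝ, E) M ℂ k}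
    (hα : IsOfType p q α) (hp : Module.finrank ℂ E < p) : α = 0 := by
  funext x
  have hx : IsOfTypeAt p q (show E [⋀^Fin k]→L[ℝ] ℂ from α x) := ⟨hα.1, fun θ v => hα.2 x θ v⟩
  have hmem := hx.mem_typeSubmodule
  rw [typeSubmodule_eq_bot_of_finrank_lt_left hα.1 hp, Submodule.mem_bot] at hmem
  exact hmem

/-- **A form of type `(p,q)` with `q > dim_ℂ E` is zero.** [cite: Voisin2002, §2.3.1 eq. (2.4)] -/
theorem MForm.eq_zero_of_isOfType_of_finrank_lt_right {k p q : ℕ} {α : MForm 𝓘(ℝ, E) M ℂ k}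
    (hα : IsOfType p q α) (hq : Module.finrank ℂ E < q) : α = 0 := by
  funext x
  have hx : IsOfTypeAt p q (show E [⋀^Fin k]→L[ℝ] ℂ from α x) := ⟨hα.1, fun θ v => hα.2 x θ v⟩
  have hmem := hx.mem_typeSubmodule
  rw [typeSubmodule_eq_bot_of_finrank_lt_right hα.1 hq, Submodule.mem_bot] at hmem
  exact hmem

/-- In particular a holomorphic `k`-form with `k > dim_ℂ E` is zero. [cite: Voisin2002, §2.3.1 eq. (2.4)] -/
theorem eq_zero_of_isHolomorphicForm_of_finrank_lt {k : ℕ} {α : MForm 𝓘(ℝ, E) M ℂ k}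
    (hα : IsHolomorphicForm α) (hk : Module.finrank ℂ E < k) : α = 0 :=
  MForm.eq_zero_of_isOfType_of_finrank_lt_left hα.2.1 hk

/-! ### Theorem 5.2.7: de Rham cohomology above the dimension -/

section Manifold

variable [IsManifold 𝓘(ℂ, E) ω M] [IsManifold 𝓘(ℝ, E) ∞ M]

/-- **`Hʳ_dR(M; ℂ) = 0` for `r > dim M` on a `∂̄`-acyclic complex manifold** (Hörmander (1973),
Thm. 5.2.7: "If `Ω` is a Stein manifold of dimension `n`, then `Hʳ(Ω, ℂ) = 0` when `r > n`", with the
Stein hypothesis entering through its consequence `H^{p,q+1}_{∂̄}(M) = 0` for all `p, q` (Cor. 5.2.6,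
Cartan's Theorem B) and `Hʳ(Ω, ℂ)` the smooth-forms de Rham cohomology). Proof (Thm. 2.7.10):
every class has a closed holomorphic representative of type `(r,0)`
(`exists_isHolomorphicForm_mk_eq_of_forall_subsingleton`), which vanishes for `r > dim_ℂ E`.
[cite: HormanderSCV1973, Thm. 5.2.7] -/
theorem subsingleton_complexDeRhamCohomology_of_forall_subsingleton_dolbeaultCohomology
    (hB : ∀ p q : ℕ, Subsingleton (dolbeaultCohomology E M p (q + 1))) {r : ℕ}
    (hr : Module.finrank ℂ E < r) : Subsingleton (complexDeRhamCohomology E M r) := by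
  refine ⟨fun x y => ?_⟩
  obtain ⟨η, hη, hηh, rfl⟩ := exists_isHolomorphicForm_mk_eq_of_forall_subsingleton hB r x
  obtain ⟨η', hη', hη'h, rfl⟩ := exists_isHolomorphicForm_mk_eq_of_forall_subsingleton hB r y
  have h1 : η = 0 := eq_zero_of_isHolomorphicForm_of_finrank_lt hηh hr
  have h2 : η' = 0 := eq_zero_of_isHolomorphicForm_of_finrank_lt hη'h hr
  congr 1
  exact Subtype.ext (h1.trans h2.symm)

/-- The degree-sharp form: `Hʳ_dR(M; ℂ) = 0` as soon as `H^{p,q+1}_{∂̄}(M) = 0` for the bidegrees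
`p + q + 1 = r` and `r > dim_ℂ E`. [cite: HormanderSCV1973, Thm. 2.7.10] -/
theorem subsingleton_complexDeRhamCohomology_of_subsingleton_dolbeaultCohomology
    {r : ℕ} (hB : ∀ p q : ℕ, p + q + 1 = r → Subsingleton (dolbeaultCohomology E M p (q + 1)))
    (hr : Module.finrank ℂ E < r) : Subsingleton (complexDeRhamCohomology E M r) := by
  refine ⟨fun x y => ?_⟩
  obtain ⟨η, hη, hηh, rfl⟩ := exists_isHolomorphicForm_mk_eq_of_subsingleton_dolbeaultCohomology hB x
  obtain ⟨η', hη', hη'h, rfl⟩ := exists_isHolomorphicForm_mk_eq_of_subsingleton_dolbeaultCohomology hB y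
  have h1 : η = 0 := eq_zero_of_isHolomorphicForm_of_finrank_lt hηh hr
  have h2 : η' = 0 := eq_zero_of_isHolomorphicForm_of_finrank_lt hη'h hr
  congr 1
  exact Subtype.ext (h1.trans h2.symm)

end Manifold

/-! ### Instances: Runge open sets and hypersurface complements in `ℂ^ι` -/

section Pi

variable {ι : Type u} [Fintype ι] [DecidableEq ι]

/-- **Hörmander's Theorem 2.7.11 (case `r > n`)**: if `U ⊆ ℂ^ι` is open with `K̃ ⊆ U` for every
compact `K ⊆ U` (a Runge open set: condition (ii)/(iv) of Thm. 2.7.3), then `Hʳ_dR(U; ℂ) = 0` for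
`r > n = |ι|` — from Theorem 2.7.8 (`subsingleton_dolbeaultCohomology_of_holomorphicHull_subset`) and
Theorem 2.7.10. (The printed theorem also covers `r = n`, not proved here.)
[cite: HormanderSCV1973, Thm. 2.7.11] -/
theorem subsingleton_complexDeRhamCohomology_of_holomorphicHull_subset
    (U : TopologicalSpace.Opens (ι → ℂ))
    (hR : ∀ K ⊆ (U : Set (ι → ℂ)), IsCompact K → holomorphicHull (ι → ℂ) (ι → ℂ) K ⊆ U)
    {r : ℕ} (hr : Fintype.card ι < r) : Subsingleton (complexDeRhamCohomology (ι → ℂ) U r) :=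
  subsingleton_complexDeRhamCohomology_of_forall_subsingleton_dolbeaultCohomology
    (fun p q => subsingleton_dolbeaultCohomology_of_holomorphicHull_subset U hR p q)
    (by simpa using hr)

/-- **`Hʳ_dR = 0` for `r > n` on complements of entire hypersurfaces in open analytic polyhedra**:
`U = {z ∈ ℂ^ι : |P_j z| < 1 ∀ j, Q_i z ≠ 0 ∀ i}` (`P_j, Q_i` entire) — e.g. `(ℂ^*)^S × ℂ^{ι∖S}`, basic
opens `D(Q)` — has `Hʳ_dR(U; ℂ) = 0` for `r > |ι|` (Hörmander (1973), Thm. 5.2.7 for this Stein open set;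
here from `subsingleton_dolbeaultCohomology_of_forall_norm_lt_of_forall_ne_zero` and Thm. 2.7.10).
[cite: HormanderSCV1973, Thm. 5.2.7] -/
theorem subsingleton_complexDeRhamCohomology_of_forall_norm_lt_of_forall_ne_zero
    {κ : Type*} [Fintype κ] {κ' : Type*} [Fintype κ'] [DecidableEq κ']
    (P : κ → (ι → ℂ) → ℂ) (hP : ∀ j, Differentiable ℂ (P j)) (Q : κ' → (ι → ℂ) → ℂ)
    (hQ : ∀ i, Differentiable ℂ (Q i)) (U : TopologicalSpace.Opens (ι → ℂ))
    (hU : (U : Set (ι → ℂ)) = {z | (∀ j, ‖P j z‖ < 1) ∧ ∀ i, Q i z ≠ 0})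
    {r : ℕ} (hr : Fintype.card ι < r) : Subsingleton (complexDeRhamCohomology (ι → ℂ) U r) :=
  subsingleton_complexDeRhamCohomology_of_forall_subsingleton_dolbeaultCohomology
    (fun p q => subsingleton_dolbeaultCohomology_of_forall_norm_lt_of_forall_ne_zero P hP Q hQ U hU p q)
    (by simpa using hr)

/-- `Hʳ_dR((ℂ^*)^S × ℂ^{ι∖S}; ℂ) = 0` for `r > |ι|`, for the open submanifold
`U = {z : z_i ≠ 0 ∀ i ∈ S}` of `ℂ^ι`. [cite: HormanderSCV1973, Thm. 5.2.7] -/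
theorem subsingleton_complexDeRhamCohomology_coordCompl (S : Finset ι)
    (U : TopologicalSpace.Opens (ι → ℂ)) (hU : (U : Set (ι → ℂ)) = {z | ∀ i ∈ S, z i ≠ 0})
    {r : ℕ} (hr : Fintype.card ι < r) : Subsingleton (complexDeRhamCohomology (ι → ℂ) U r) :=
  subsingleton_complexDeRhamCohomology_of_forall_subsingleton_dolbeaultCohomology
    (fun p q => subsingleton_dolbeaultCohomology_coordCompl S U hU p q) (by simpa using hr)

end Pi

end Literature.Geometry.Kaehler

end
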